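import Literature.Computability.QuantumComplexity.JonesSamplerAnalysis
import HarnessLib

/-!
# The van Dam–Seroussi sampler: many interference copies and Chebyshev's inequality

Topic `Literature/Computability/Cryptography`; support for the discharge of
`VanDamSeroussi2002_gaussSumPhase_qsolvable`. van Dam–Seroussi 2002 (§4, proof of Thm. 1) estimate the
phase from the STATISTICS of repeated interference experiments: `K` copies read the control qubit
after a Hadamard (a coin of bias `(1 + cos Δ)/2`), `K` copies after `S` then a Hadamard
(`(1 + sin Δ)/2`), and the two empirical means estimate `cos Δ`, `sin Δ` — the sampling step of
Kitaev's phase estimation (Kitaev 1995, §3, Chebyshev before Lemma 9) as in the AJL sampler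
(`JonesSamplerAnalysis.lean`, whose `Trial`, `block`, `count`, `estimate` are reused). Unlike the AJL
file the two coin biases here are ARBITRARY numbers `P false, P true ∈ [0, 1]` (the actual
probabilities of the circuit, only approximately `(1 ∓ Re z)/2`, `(1 ∓ Im z)/2`):

* `Sampler.testProb P t c`, `Sampler.weight P γ` (the product law), `Sampler.pr` (event weights) with
  `sum_weight`, `pr_mono`, `pr_or_le`, `pr_add_pr_not`;
* `Sampler.weight_deviation_le` — Chebyshev per type (`Kitaev1995.chebyshev_block`);
* `Sampler.Good P η` — both counts within `Kη/2` of their means; **`Sampler.pr_not_good_le`**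
  (`≤ 2/(Kη²)`), `Sampler.abs_estimate_sub_lt_of_good` (then `|estimate − (1 − 2P_t)| < η`);
* **`Sampler.pr_ge_of_good_imp`** — an event implied by `Good` has weight `≥ 1 − 2/(Kη²)`.

Everything is proved; the definitions have bodies; no named fact.

## References

* W. van Dam, G. Seroussi, arXiv:quant-ph/0207131 (2002), §4 Thm. 1 (proof) [VanDamSeroussi2002].
* A. Yu. Kitaev, arXiv:quant-ph/9511026 (1995), §3 (the Chebyshev estimate before Lemma 9) [Kitaev1995].
* D. Aharonov, V. Jones, Z. Landau, Algorithmica 55 (2009), §3.3 (Claim 3.3) [AharonovJonesLandau2009].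
-/

noncomputable section

open Finset

namespace Literature.Computability.Cryptography

namespace VanDamSeroussi

namespace Sampler

open Literature.Computability.QuantumComplexity.AJLSampler (Trial block count estimate card_block)

variable {K : ℕ}

/-! ### The product law of the copies -/

/-- The probability that a copy of type `t` reads `c`: `P t` for `c = 1`, `1 − P t` for `c = 0`.
[cite: VanDamSeroussi2002, §4 Thm. 1 (proof)] -/
def testProb (P : Bool → ℝ) (t c : Bool) : ℝ := if c then P t else 1 - P t

/-- The weight (probability) of a complete outcome `γ` of the `2K` independent copies (the product
law of disjoint blocks measured together). [cite: Kitaev1995, §3] -/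
def weight (P : Bool → ℝ) (γ : Trial K → Bool) : ℝ := ∏ j, testProb P j.1 (γ j)

/-- The weight of an event. [folklore] -/
def pr (P : Bool → ℝ) (E : (Trial K → Bool) → Prop) [DecidablePred E] : ℝ :=
  ∑ γ : Trial K → Bool, if E γ then weight P γ else 0

variable {P : Bool → ℝ} (hP : ∀ t, 0 ≤ P t ∧ P t ≤ 1)
include hP

/-- Test probabilities are nonnegative. [folklore] -/
theorem testProb_nonneg (t c : Bool) : 0 ≤ testProb P t c := by
  unfold testProb; have := hP t; split_ifs <;> linarith

omit hP in
/-- Test probabilities of one copy sum to one. [folklore] -/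
theorem testProb_add (P : Bool → ℝ) (t : Bool) : testProb P t false + testProb P t true = 1 := by
  simp [testProb]

/-- Weights are nonnegative. [folklore] -/
theorem weight_nonneg (γ : Trial K → Bool) : 0 ≤ weight P γ :=
  prod_nonneg fun j _ => testProb_nonneg hP j.1 (γ j)

omit hP in
/-- **The weights sum to one.** [folklore] -/
theorem sum_weight (P : Bool → ℝ) : ∑ γ : Trial K → Bool, weight P γ = 1 := by
  have h := Kitaev1995.sum_prodWeight (fun (j : Trial K) c => testProb P j.1 c) fun j => testProb_add P j.1
  simpa only [weight] using h

omit hP in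
/-- The mean number of ones in the block of type `t` is `K · P t`. [folklore] -/
theorem sum_block_testProb (P : Bool → ℝ) (t : Bool) : ∑ j ∈ block K t, testProb P j.1 true = K * P t := by
  rw [block, sum_map]
  simp [Function.Embedding.sectR, testProb]

/-- Monotonicity of event weights. [folklore] -/
theorem pr_mono {E F : (Trial K → Bool) → Prop} [DecidablePred E] [DecidablePred F] (h : ∀ γ, E γ → F γ) :
    pr P E ≤ pr P F := by
  refine sum_le_sum fun γ _ => ?_
  by_cases hE : E γ
  · rw [if_pos hE, if_pos (h γ hE)]
  · rw [if_neg hE]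
    split_ifs
    · exact weight_nonneg hP γ
    · exact le_rfl

/-- Union bound. [folklore] -/
theorem pr_or_le (E F : (Trial K → Bool) → Prop) [DecidablePred E] [DecidablePred F] :
    pr P (fun γ => E γ ∨ F γ) ≤ pr P E + pr P F := by
  unfold pr
  rw [← sum_add_distrib]
  refine sum_le_sum fun γ _ => ?_
  have hw := weight_nonneg hP γ
  by_cases hE : E γ <;> by_cases hF : F γ <;> simp [hE, hF, hw]

omit hP in
/-- Complementary events. [folklore] -/
theorem pr_add_pr_not (P : Bool → ℝ) (E : (Trial K → Bool) → Prop) [DecidablePred E] :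
    pr P E + pr P (fun γ => ¬ E γ) = 1 := by
  unfold pr
  rw [← sum_add_distrib, ← sum_weight (K := K) P]
  refine sum_congr rfl fun γ _ => ?_
  by_cases hE : E γ <;> simp [hE]

/-! ### Chebyshev per type -/

/-- **Chebyshev's inequality for the copies of one type**: the outcomes whose number of ones of type `t`
deviates from `K · P t` by at least `a > 0` have weight `≤ K/(4a²)`. [cite: Kitaev1995, §3 (Lemma 9)] -/
theorem weight_deviation_le (t : Bool) {a : ℝ} (ha : 0 < a) :
    pr P (fun γ : Trial K → Bool => a ≤ |(count t γ : ℝ) - K * P t|) ≤ K / (4 * a ^ 2) := by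
  have h := Kitaev1995.chebyshev_block (fun (j : Trial K) c => testProb P j.1 c)
    (fun j c => testProb_nonneg hP j.1 c) (fun j => testProb_add P j.1) (block K t) ha
  rw [sum_block_testProb, card_block] at h
  unfold pr
  rw [← sum_filter]
  exact h

omit hP in
/-- If the count is within `a` of its mean then the empirical mean `1 − 2c/K` is within `2a/K` of
`1 − 2 P t`. [cite: VanDamSeroussi2002, §4 Thm. 1 (proof)] -/
theorem abs_estimate_sub_lt (P : Bool → ℝ) (t : Bool) (hK : 0 < K) {c : ℕ} {a : ℝ}
    (h : |(c : ℝ) - K * P t| < a) : |estimate K c - (1 - 2 * P t)| < 2 * a / K := by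
  have hK' : (0 : ℝ) < K := by exact_mod_cast hK
  have key : estimate K c - (1 - 2 * P t) = -(2 / K) * ((c : ℝ) - K * P t) := by
    unfold estimate; field_simp; ring
  rw [key, abs_mul, abs_neg, abs_of_pos (by positivity : (0 : ℝ) < 2 / K)]
  calc 2 / (K : ℝ) * |(c : ℝ) - K * P t| < 2 / K * a := mul_lt_mul_of_pos_left h (by positivity)
    _ = 2 * a / K := by ring

/-! ### The good event -/

/-- **The good event**: both counts within `Kη/2` of their means. [cite: VanDamSeroussi2002, §4 Thm. 1 (proof)] -/
def Good (P : Bool → ℝ) (η : ℝ) (K : ℕ) (γ : Trial K → Bool) : Prop :=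
  |(count false γ : ℝ) - K * P false| < K * η / 2 ∧ |(count true γ : ℝ) - K * P true| < K * η / 2

omit hP in
/-- The good event is decidable (classically). [folklore] -/
instance instDecidablePredGood (P : Bool → ℝ) (η : ℝ) (K : ℕ) : DecidablePred (Good P η K) := fun _ => by
  unfold Good; infer_instance

/-- **The bad event has weight at most `2/(Kη²)`** (Chebyshev twice and a union bound).
[cite: Kitaev1995, §3 (Lemma 9)] [cite: VanDamSeroussi2002, §4 Thm. 1 (proof)] -/
theorem pr_not_good_le {η : ℝ} (hη : 0 < η) (hK : 0 < K) :
    pr P (fun γ : Trial K → Bool => ¬ Good P η K γ) ≤ 2 / (K * η ^ 2) := by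
  have hK' : (0 : ℝ) < K := by exact_mod_cast hK
  set a : ℝ := K * η / 2 with ha_def
  have ha : 0 < a := by positivity
  have hR := weight_deviation_le (K := K) hP false ha
  have hI := weight_deviation_le (K := K) hP true ha
  have hval : (K : ℝ) / (4 * a ^ 2) = 1 / (K * η ^ 2) := by
    rw [ha_def]; field_simp; ring
  rw [hval] at hR hI
  calc pr P (fun γ : Trial K → Bool => ¬ Good P η K γ)
      ≤ pr P (fun γ : Trial K → Bool => a ≤ |(count false γ : ℝ) - K * P false| ∨ a ≤ |(count true γ : ℝ) - K * P true|) := by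
        refine pr_mono hP fun γ hγ => ?_
        unfold Good at hγ
        rw [not_and_or, not_lt, not_lt] at hγ
        exact hγ
    _ ≤ 1 / (K * η ^ 2) + 1 / (K * η ^ 2) := (pr_or_le hP _ _).trans (add_le_add hR hI)
    _ = 2 / (K * η ^ 2) := by ring

omit hP in
/-- **On the good event both empirical means are within `η`** of `1 − 2 P t`. [cite: VanDamSeroussi2002, §4 Thm. 1 (proof)] -/
theorem abs_estimate_sub_lt_of_good {η : ℝ} (hK : 0 < K) {γ : Trial K → Bool} (hγ : Good P η K γ) (t : Bool) :
    |estimate K (count t γ) - (1 - 2 * P t)| < η := by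
  have hK' : (0 : ℝ) < K := by exact_mod_cast hK
  have key : ∀ t, |(count t γ : ℝ) - K * P t| < K * η / 2 → |estimate K (count t γ) - (1 - 2 * P t)| < η := by
    intro t h
    have := abs_estimate_sub_lt P t hK h
    rwa [show 2 * (K * η / 2) / (K : ℝ) = η by field_simp] at this
  cases t
  · exact key false hγ.1
  · exact key true hγ.2

/-- **An event implied by the good event has weight at least `1 − 2/(Kη²)`.** [cite: VanDamSeroussi2002, §4 Thm. 1 (proof)] [cite: Kitaev1995, §3] -/
theorem pr_ge_of_good_imp {η : ℝ} (hη : 0 < η) (hK : 0 < K) (E : (Trial K → Bool) → Prop) [DecidablePred E]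
    (hE : ∀ γ, Good P η K γ → E γ) : 1 - 2 / (K * η ^ 2) ≤ pr P E := by
  have h1 := pr_add_pr_not (K := K) P (Good P η K)
  have h2 := pr_not_good_le hP hη hK
  have h3 : pr P (Good P η K) ≤ pr P E := pr_mono hP hE
  linarith

end Sampler

end VanDamSeroussi

end Literature.Computability.Cryptography

end
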